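import Summits.QuantumFields.BalabanUV.Beta.GAN24.SourceSidePair
import Summits.QuantumFields.BalabanUV.Beta.GAN24.CapacitanceScalarDictionary

/-!
# `BalabanUV.Beta.GAN24.SourceSideDict` — binder row G-an2-4 / (CONV-C), road P1-fibre, sub-part **PART S** of gan24-p1's row
# **P1-L11** `FibreRate` (leaf-20-g7's division, CLAIMS l.3039; TAKE l.3074) — PART 2: the SOURCE-SIDE sums `S_φ`, `S_c` ARE alias-box sums
# of the label models `termPhi`, `termC` (T00 currency in, `CapacitanceScalarRateTerm.boxZ/qv` currency out)

NOT IN PRINT; OUR PROOF ATTEMPT.  HONEST FRAMING (cell contract, verbatim): «discharging `BetaPertH` makes Bałaban's UV stability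
UNCONDITIONAL — a real constructive-QFT result; it is NOT the continuum limit and NOT the Clay problem.»  HONEST DEPENDENCY (verbatim):
«continuum YM on T⁴ ⇐ BetaPertH ∧ nine spine estimates (0/9 proved); BetaPertH ⇐ (D1) ∧ (D4) ∧ CAP+tail; G-an2-4 gates asym, D1 and
NE2/3/4.»  [folklore] algebra (`2π`-periodicity of the T00 building blocks, the two telescoping identities of the geometric sums, casts);
0 cite, 0 wall binder, no `def … : Prop`; four harmless complex-valued `def`s (`srcPh`, `eM`, `termC`, `termPhi` — the label models).
It discharges NOTHING of (CONV-C)'s K-slot `GAN24.CombesThomas.ConvCK 3 Lc` by itself.  NOT `BetaPertH`, NOT continuum, NOT Clay.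
Value = kernel bookkeeping toward the K-slot route P1 of binder row G-an2-4, NOT summit progress.

## What is proved (objects of typer row T00 `GAN24/AliasObjects` BY NAME, nothing redefined)
At `p = ofRealVec q`, `q ∈ [−π, π]^D ∖ {0}` (so `reg N p = univ`, `CapacitanceScalarDictionary.LAl_ofRealVec_ne_zero`), block side `N`,
decimation side `M`, `N = M·Lc`, for the field-leg source `fhatF N M p l y′` (force `e_l` at the coarse point `y′`, T00 §5):
* §1 label models: the level-free source phase `srcPh Lc y′ Q = e^{−i(Q·y′)/Lc}`, the level-free telescoped factor
  `eM Lc Q_l = e^{−iQ_l/Lc} − 1`, and the summand models `termC`, `termPhi` (see their docstrings);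
* §2 the `2π`-periodicity dictionary in the abstract form `kAl N p m = k + 2π·n` (pattern of `GAN24/AliasReindex` §4) and the ZONE
  LABEL decomposition `kAl N (ofRealVec q) m = (q + 2π·zvec N q m)/N + 2π·n` (leaf P1-Y11s `kfine_eq_qv_add` BY NAME);
* §3 the TELESCOPING IDENTITIES at the label: `s♭_{M,l}(m)·∂♭_{m,l} = e^{−iQ_l/Lc} − 1` (LEVEL-free) and `s_{l′}(m)·∂_{m,l′} = ∂̂(p)_{l′}`
  (LABEL-free) — leaf-02's (T2)/(T1) at decimation resp. box level, from leaf P1-L06's `geomExp_mul_sub_one` BY NAME — and the pairing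
  `s_i(m)·s♭_{M,i}(m) = N·M·pairP N M Q_i`;
* §4 **`srcC_fhatF_eq`**: `srcC N p (fhatF N M p l y′) = N³ · Σ_{z ∈ boxZ N q} termC N M Lc l y′ (q + 2πz)` and
  **`srcPhi_fhatF_eq`**: `srcPhi N p (fhatF N M p l y′) 0 l′ = N³ · Σ_{z ∈ boxZ N q} termPhi N M Lc q l′ l y′ (q + 2πz)` —
  unit `N³`, every summand a function of the zone label built from part 1's `pairP`, `CapacitanceScalarRate.symN`, `srcPh`, `eM`, `dhat p`.
The estimates are parts 3–6: bounds `SourceSideBound`; two-level rates `SourceSideRate` (`S_c`) and `SourceSideRatePhi`/`SourceSideRatePhiSum`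
(`S_φ`, plus PART R = conj PART S).

Unit `b2b-balaban-gan24-formalise-leaf-07` (G-an2-4 formalisation swarm, leaf prover 07, gen 6), 2026-08-20.
-/

noncomputable section

open Complex Finset
open scoped BigOperators Real ComplexConjugate

namespace Summit.QuantumFields.BalabanUV.Beta.GAN24.SourceSideDict

open Literature.Probability.LatticeModels (TorusSite)
open Literature.MathematicalPhysics.QuantumFieldTheory.Balaban1983to89.B4Strip (ofRealVec)
open Literature.MathematicalPhysics.QuantumFieldTheory.King1986 (momSq)
open FibreSymbols (dhat dflat lapSym)
open FibreBlockSolve (dot)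
open AliasWeights AliasWeightsSum CapacitanceScalarRate CapacitanceScalarRateTerm CapacitanceScalarRateBox SourceSidePair
open AliasObjects
open AliasReindex (gs_add_two_pi_mul gs_neg_add_two_pi_mul cexp_I_mul_add_two_pi_mul' dhat_add_two_pi dflat_add_two_pi
  lapSym_add_two_pi)

variable {D : ℕ}

/-! ## §1 The label models -/

/-- The LEVEL-FREE source phase `e^{−i Σ_i Q_i y′_i / Lc}` (the phase `e^{−i k_m·(M y′)}` of T00's `srcW` at the zone label, `k_m M = Q/Lc`). -/
def srcPh (Lc : ℕ) (y' : Fin D → ℤ) (Q : Fin D → ℝ) : ℂ := cexp (-(I * ∑ i, ((Q i / Lc : ℝ) : ℂ) * (y' i : ℂ)))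

/-- The LEVEL-FREE telescoped factor `eM Lc x = e^{−ix/Lc} − 1` (`= s♭_{M,l}(m)·∂♭_{m,l}` at `x = Q_l`). -/
def eM (Lc : ℕ) (x : ℝ) : ℂ := cexp (-(I * ((x / Lc : ℝ) : ℂ))) - 1

/-- The label model of the `S_c` summand (unit `N³` removed): `termC = −Lc · srcPh · (Π_i pairP N M Q_i) · eM Lc Q_l / symN N Q ²`. -/
def termC (N M Lc : ℕ) (l : Fin D) (y' : Fin D → ℤ) (Q : Fin D → ℝ) : ℂ :=
  -((Lc : ℂ) * srcPh Lc y' Q * (∏ i, pairP N M (Q i)) * eM Lc (Q l) / ((symN N Q : ℝ) : ℂ) ^ 2)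

/-- The label model of the `S_φ` summand (unit `N³` removed), entry `l′` for the force leg `l`:
`termPhi = −srcPh · (Π_i pairP N M Q_i) · [δ_{l′l} · pairP N M Q_l/(2 symN) − Lc · ∂̂(p)_{l′} · eM Lc Q_l/(2 symN²)]`. -/
def termPhi (N M Lc : ℕ) (q : Fin D → ℝ) (l' l : Fin D) (y' : Fin D → ℤ) (Q : Fin D → ℝ) : ℂ :=
  -(srcPh Lc y' Q * (∏ i, pairP N M (Q i)) *
    ((if l' = l then pairP N M (Q l) / (2 * ((symN N Q : ℝ) : ℂ)) else 0)
      - (Lc : ℂ) * dhat (ofRealVec q) l' * eM Lc (Q l) / (2 * ((symN N Q : ℝ) : ℂ) ^ 2)))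

/-- [folklore] The source phase is unimodular. -/
theorem norm_srcPh (Lc : ℕ) (y' : Fin D → ℤ) (Q : Fin D → ℝ) : ‖srcPh Lc y' Q‖ = 1 := by
  unfold srcPh
  have h : -(I * ∑ i, ((Q i / Lc : ℝ) : ℂ) * (y' i : ℂ)) = I * ((-(∑ i, Q i / Lc * (y' i : ℝ)) : ℝ) : ℂ) := by
    push_cast; ring
  rw [h, Complex.norm_exp_I_mul_ofReal]

/-- [folklore] `‖eM Lc x‖ = 2|sin(x/(2Lc))|`. -/
theorem norm_eM (Lc : ℕ) (x : ℝ) : ‖eM Lc x‖ = 2 * |Real.sin (x / Lc / 2)| := by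
  unfold eM
  rw [show -(I * ((x / Lc : ℝ) : ℂ)) = I * ((-(x / Lc) : ℝ) : ℂ) by push_cast; ring, Complex.norm_exp_I_mul_ofReal_sub_one,
    Real.norm_eq_abs, abs_mul, abs_two, show -(x / (Lc : ℝ)) / 2 = -(x / Lc / 2) by ring, Real.sin_neg, abs_neg]

/-- [folklore] `‖eM Lc x‖ ≤ 2`. -/
theorem norm_eM_le_two (Lc : ℕ) (x : ℝ) : ‖eM Lc x‖ ≤ 2 := by
  rw [norm_eM]
  have := Real.abs_sin_le_one (x / Lc / 2)
  linarith

/-- [folklore] `‖eM Lc x‖ ≤ |x|/Lc` (`Lc ≥ 1`; the factor `|q_l|/Lc` of the zero alias). -/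
theorem norm_eM_le_abs {Lc : ℕ} (hLc : 0 < Lc) (x : ℝ) : ‖eM Lc x‖ ≤ |x| / Lc := by
  have hLcr : (0 : ℝ) < Lc := by exact_mod_cast hLc
  rw [norm_eM]
  have h := Real.abs_sin_le_abs (x := x / Lc / 2)
  rw [abs_div, abs_div, abs_two, abs_of_pos hLcr] at h
  linarith

/-! ## §2 The `2π`-periodicity dictionary for a decomposition `kAl N p m = k + 2π·n`, and the zone label -/

section Periodicity

variable {N : ℕ} [NeZero N] {p : Fin D → ℂ} {m : TorusSite D N} {k : Fin D → ℂ} {n : Fin D → ℤ}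

/-- [folklore] `s_κ(m) = gs k_κ N`. -/
theorem sAl_of_decomp (hk : kAl N p m = fun i => k i + 2 * π * (n i : ℂ)) (κ : Fin D) : sAl N p m κ = gs (k κ) N := by
  show gs (kAl N p m κ) N = _
  rw [hk]
  exact gs_add_two_pi_mul _ _ _

/-- [folklore] `S(m) = Π_i gs k_i N`. -/
theorem SAl_of_decomp (hk : kAl N p m = fun i => k i + 2 * π * (n i : ℂ)) : SAl N p m = ∏ i, gs (k i) N :=
  Finset.prod_congr rfl fun i _ => sAl_of_decomp hk i

/-- [folklore] `s♭_{M,κ}(m) = gs (−k_κ) M`. -/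
theorem sbMAl_of_decomp (hk : kAl N p m = fun i => k i + 2 * π * (n i : ℂ)) (M : ℕ) (κ : Fin D) :
    sbMAl N M p m κ = gs (-k κ) M := by
  show gs (-kAl N p m κ) M = _
  rw [hk]
  exact gs_neg_add_two_pi_mul _ _ _

/-- [folklore] `S♭_M(m) = Π_i gs (−k_i) M`. -/
theorem SbMAl_of_decomp (hk : kAl N p m = fun i => k i + 2 * π * (n i : ℂ)) (M : ℕ) : SbMAl N M p m = ∏ i, gs (-k i) M :=
  Finset.prod_congr rfl fun i _ => sbMAl_of_decomp hk M i

/-- [folklore] `∂_m = ∂̂(k)`. -/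
theorem dAl_of_decomp (hk : kAl N p m = fun i => k i + 2 * π * (n i : ℂ)) (κ : Fin D) : dAl N p m κ = dhat k κ := by
  show dhat (kAl N p m) κ = _
  rw [hk, dhat_add_two_pi]

/-- [folklore] `∂♭_m = ∂̂♭(k)`. -/
theorem dbAl_of_decomp (hk : kAl N p m = fun i => k i + 2 * π * (n i : ℂ)) (κ : Fin D) : dbAl N p m κ = dflat k κ := by
  show dflat (kAl N p m) κ = _
  rw [hk, dflat_add_two_pi]

/-- [folklore] `L_m = L(k)`. -/
theorem LAl_of_decomp (hk : kAl N p m = fun i => k i + 2 * π * (n i : ℂ)) : LAl N p m = lapSym k := by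
  show lapSym (kAl N p m) = _
  rw [hk, lapSym_add_two_pi]

/-- [folklore] The source phase is a function of `k` (`M y′ ∈ ℤ^D`). -/
theorem srcPhase_of_decomp (hk : kAl N p m = fun i => k i + 2 * π * (n i : ℂ)) (M : ℕ) (ρ : Fin D → ℤ) :
    cexp (-(I * ∑ i, kAl N p m i * ((M : ℂ) * (ρ i : ℂ)))) = cexp (-(I * ∑ i, k i * ((M : ℂ) * (ρ i : ℂ)))) := by
  have e : -(I * ∑ i, kAl N p m i * ((M : ℂ) * (ρ i : ℂ))) =
      -(I * ∑ i, k i * ((M : ℂ) * (ρ i : ℂ))) + ((-(∑ i, n i * ((M : ℤ) * ρ i)) : ℤ) : ℂ) * (2 * π * I) := by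
    rw [hk, Int.cast_neg, Int.cast_sum, Finset.mul_sum, Finset.mul_sum, neg_mul, Finset.sum_mul, ← Finset.sum_neg_distrib,
      ← Finset.sum_neg_distrib, ← Finset.sum_neg_distrib, ← Finset.sum_add_distrib]
    refine Finset.sum_congr rfl fun i _ => ?_
    push_cast
    ring
  rw [e, Complex.exp_add, Complex.exp_int_mul_two_pi_mul_I, mul_one]

/-- [folklore] The source weight is a function of `k`. -/
theorem srcW_of_decomp (hk : kAl N p m = fun i => k i + 2 * π * (n i : ℂ)) (M : ℕ) (κ : Fin D) (ρ : Fin D → ℤ) :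
    srcW N M p m κ ρ = cexp (-(I * ∑ i, k i * ((M : ℂ) * (ρ i : ℂ)))) * (∏ i, gs (-k i) M) * gs (-k κ) M /
      (M : ℂ) ^ (D + 1) / (N : ℂ) ^ D := by
  rw [srcW, srcPhase_of_decomp hk, SbMAl_of_decomp hk, sbMAl_of_decomp hk]

end Periodicity

/-- [folklore] **THE ZONE LABEL DECOMPOSITION**: `kAl N (ofRealVec q) m = (q + 2π·zvec N q m)/N + 2π·n` for some `n ∈ ℤ^D`
(leaf P1-Y11s `kfine_eq_qv_add` + `CapacitanceScalarDictionary.kFine_ofRealVec` BY NAME). -/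
theorem kAl_eq_label {N : ℕ} [NeZero N] (q : Fin D → ℝ) (m : TorusSite D N) :
    ∃ n : Fin D → ℤ, kAl N (ofRealVec q) m = fun i => ((qv q (zvec N q m) i / N : ℝ) : ℂ) + 2 * π * (n i : ℂ) := by
  choose n hn using fun i => kfine_eq_qv_add q m i
  refine ⟨n, funext fun i => ?_⟩
  rw [show kAl N (ofRealVec q) m i = ((kfine N q m i : ℝ) : ℂ) from CapacitanceScalarDictionary.kFine_ofRealVec q m i, hn i]
  push_cast
  ring

/-! ## §3 The label atoms: pairing, telescoping, symbol, phase -/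

section Atoms

variable {N M Lc : ℕ}

/-- [folklore] PAIRING: `gs(Q/N, N)·gs(−Q/N, M) = (N·M)·pairP N M Q`. -/
theorem gs_mul_gs_eq_pairP (hN : 0 < N) (hM : 0 < M) (Q : ℝ) :
    gs ((Q / N : ℝ) : ℂ) N * gs (-((Q / N : ℝ) : ℂ)) M = ((N : ℂ) * M) * pairP N M Q := by
  have hNc : (N : ℂ) ≠ 0 := by exact_mod_cast hN.ne'
  have hMc : (M : ℂ) ≠ 0 := by exact_mod_cast hM.ne'
  unfold pairP
  field_simp

/-- [folklore] The `D`-fold pairing: `(Π_i gs(Q_i/N, N))·(Π_i gs(−Q_i/N, M)) = (N·M)^D · Π_i pairP N M Q_i`. -/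
theorem prod_gs_mul_prod_gs (hN : 0 < N) (hM : 0 < M) (Q : Fin D → ℝ) :
    (∏ i, gs ((Q i / N : ℝ) : ℂ) N) * (∏ i, gs (-((Q i / N : ℝ) : ℂ)) M) = ((N : ℂ) * M) ^ D * ∏ i, pairP N M (Q i) := by
  rw [← Finset.prod_mul_distrib, Finset.prod_congr rfl fun i _ => gs_mul_gs_eq_pairP hN hM (Q i), Finset.prod_mul_distrib,
    Finset.prod_const, Finset.card_univ, Fintype.card_fin]

/-- [folklore] TELESCOPING AT DECIMATION LEVEL (leaf-02's (T2) for `s♭_M`): `gs(−Q_l/N, M)·∂̂♭(Q/N)_l = e^{−iQ_l/Lc} − 1 = eM Lc Q_l`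
(`N = M·Lc`; leaf P1-L06 `geomExp_mul_sub_one` BY NAME). -/
theorem gs_neg_mul_dflat (hM : 0 < M) (hNM : N = M * Lc) (Q : Fin D → ℝ) (l : Fin D) :
    gs (-((Q l / N : ℝ) : ℂ)) M * dflat (fun i => ((Q i / N : ℝ) : ℂ)) l = eM Lc (Q l) := by
  have hMc : (M : ℂ) ≠ 0 := by exact_mod_cast hM.ne'
  have h := geomExp_mul_sub_one (-((Q l / N : ℝ) : ℂ)) M
  have key : ((Q l / N : ℝ) : ℂ) * (M : ℂ) = ((Q l / Lc : ℝ) : ℂ) := by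
    rw [hNM]; push_cast; field_simp
  unfold FibreSymbols.dflat eM
  rw [show -(I * ((Q l / N : ℝ) : ℂ)) = I * -((Q l / N : ℝ) : ℂ) by ring]
  rw [show gs (-((Q l / N : ℝ) : ℂ)) M = ∑ t ∈ Finset.range M, cexp (I * -((Q l / N : ℝ) : ℂ) * t) from rfl, h, ← key]
  congr 2
  ring

/-- [folklore] TELESCOPING AT BOX LEVEL (leaf-02's (T1)): `gs(Q_{l′}/N, N)·∂̂(Q/N)_{l′} = e^{iQ_{l′}} − 1 = ∂̂(ofRealVec q)_{l′}` at the zone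
label `Q = q + 2πz` — LABEL-free. -/
theorem gs_mul_dhat [NeZero N] (q : Fin D → ℝ) (z : Fin D → ℤ) (l' : Fin D) :
    gs ((qv q z l' / N : ℝ) : ℂ) N * dhat (fun i => ((qv q z i / N : ℝ) : ℂ)) l' = dhat (ofRealVec q) l' := by
  have hNc : (N : ℂ) ≠ 0 := by exact_mod_cast NeZero.ne N
  have h := geomExp_mul_sub_one ((qv q z l' / N : ℝ) : ℂ) N
  unfold FibreSymbols.dhat
  rw [show gs ((qv q z l' / N : ℝ) : ℂ) N = ∑ t ∈ Finset.range N, cexp (I * ((qv q z l' / N : ℝ) : ℂ) * t) from rfl, h,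
    SymbolTaylor.ofRealVec_apply]
  have e : I * ((qv q z l' / N : ℝ) : ℂ) * (N : ℂ) = I * ((q l' : ℂ) + 2 * π * (z l' : ℂ)) := by
    have : ((qv q z l' / N : ℝ) : ℂ) * (N : ℂ) = (q l' : ℂ) + 2 * π * (z l' : ℂ) := by
      unfold qv; push_cast; field_simp
    rw [mul_assoc, this]
  rw [e, cexp_I_mul_add_two_pi_mul']

/-- [folklore] THE SYMBOL AT THE LABEL: `L(Q/N) = symN N Q / N²` (`CapacitanceScalarRate.symN` and `AliasWeightsSum.lapSym_ofReal` BY NAME). -/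
theorem lapSym_label (hN : 0 < N) (Q : Fin D → ℝ) :
    lapSym (fun i => ((Q i / N : ℝ) : ℂ)) = ((symN N Q : ℝ) : ℂ) / (N : ℂ) ^ 2 := by
  have hNc : (N : ℂ) ≠ 0 := by exact_mod_cast hN.ne'
  rw [lapSym_ofReal (fun i => Q i / N), symN_eq_sq_mul_lapR]
  push_cast
  field_simp

/-- [folklore] THE SOURCE PHASE AT THE LABEL is `srcPh` (`(Q_i/N)·M = Q_i/Lc`). -/
theorem srcPhase_label (hM : 0 < M) (hNM : N = M * Lc) (Q : Fin D → ℝ) (y' : Fin D → ℤ) :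
    cexp (-(I * ∑ i, ((Q i / N : ℝ) : ℂ) * ((M : ℂ) * (y' i : ℂ)))) = srcPh Lc y' Q := by
  have hMc : (M : ℂ) ≠ 0 := by exact_mod_cast hM.ne'
  unfold srcPh
  congr 3
  refine Finset.sum_congr rfl fun i _ => ?_
  have key : ((Q i / N : ℝ) : ℂ) * (M : ℂ) = ((Q i / Lc : ℝ) : ℂ) := by
    rw [hNM]; push_cast; field_simp
  rw [← key]
  ring

end Atoms

/-! ## §4 Core algebra (pure identities in `ℂ`) -/

/-- [folklore] Core identity of the `S_c` summand. -/
theorem core_C (D : ℕ) {Nc M Lc S SA SbM sbl dbl ph P E : ℂ} (hM : M ≠ 0) (hLc : Lc ≠ 0) (hS : S ≠ 0) (hN : Nc = M * Lc)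
    (hSS : SA * SbM = (Nc * M) ^ D * P) (hE : sbl * dbl = E) :
    SA * (dbl * (ph * SbM * sbl / M ^ (D + 1) / Nc ^ D)) / (S / Nc ^ 2) ^ 2 = Nc ^ 3 * (Lc * ph * P * E / S ^ 2) := by
  have hNc : Nc ≠ 0 := by rw [hN]; exact mul_ne_zero hM hLc
  calc SA * (dbl * (ph * SbM * sbl / M ^ (D + 1) / Nc ^ D)) / (S / Nc ^ 2) ^ 2
      = (SA * SbM) * (sbl * dbl) * ph / M ^ (D + 1) / Nc ^ D / (S / Nc ^ 2) ^ 2 := by ring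
    _ = (Nc * M) ^ D * P * E * ph / M ^ (D + 1) / Nc ^ D / (S / Nc ^ 2) ^ 2 := by rw [hSS, hE]
    _ = Nc ^ 3 * (Lc * ph * P * E / S ^ 2) := by rw [hN]; field_simp; ring

/-- [folklore] Core identity of the `δ`-part of the `S_φ` summand. -/
theorem core_Phi_delta (D : ℕ) {Nc M S SA SbM sl sbl ph P Pl : ℂ} (hM : M ≠ 0) (hNc : Nc ≠ 0) (hS : S ≠ 0)
    (hSS : SA * SbM = (Nc * M) ^ D * P) (hsl : sl * sbl = (Nc * M) * Pl) :
    SA / (2 * (S / Nc ^ 2)) * sl * (ph * SbM * sbl / M ^ (D + 1) / Nc ^ D) = Nc ^ 3 * (ph * P * (Pl / (2 * S))) := by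
  calc SA / (2 * (S / Nc ^ 2)) * sl * (ph * SbM * sbl / M ^ (D + 1) / Nc ^ D)
      = (SA * SbM) * (sl * sbl) * ph / (2 * (S / Nc ^ 2)) / M ^ (D + 1) / Nc ^ D := by ring
    _ = (Nc * M) ^ D * P * ((Nc * M) * Pl) * ph / (2 * (S / Nc ^ 2)) / M ^ (D + 1) / Nc ^ D := by rw [hSS, hsl]
    _ = Nc ^ 3 * (ph * P * (Pl / (2 * S))) := by field_simp; ring

/-- [folklore] Core identity of the projector part of the `S_φ` summand. -/
theorem core_Phi_proj (D : ℕ) {Nc M Lc S SA SbM sl dl sbl dbl ph P Ep E : ℂ} (hM : M ≠ 0) (hLc : Lc ≠ 0) (hS : S ≠ 0)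
    (hN : Nc = M * Lc) (hSS : SA * SbM = (Nc * M) ^ D * P) (hEp : sl * dl = Ep) (hE : sbl * dbl = E) :
    SA / (2 * (S / Nc ^ 2)) * sl * (dl * (dbl * (ph * SbM * sbl / M ^ (D + 1) / Nc ^ D)) / (S / Nc ^ 2))
      = Nc ^ 3 * (ph * P * (Lc * Ep * E / (2 * S ^ 2))) := by
  have hNc : Nc ≠ 0 := by rw [hN]; exact mul_ne_zero hM hLc
  calc SA / (2 * (S / Nc ^ 2)) * sl * (dl * (dbl * (ph * SbM * sbl / M ^ (D + 1) / Nc ^ D)) / (S / Nc ^ 2))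
      = (SA * SbM) * (sl * dl) * (sbl * dbl) * ph / (2 * (S / Nc ^ 2)) / M ^ (D + 1) / Nc ^ D / (S / Nc ^ 2) := by ring
    _ = (Nc * M) ^ D * P * Ep * E * ph / (2 * (S / Nc ^ 2)) / M ^ (D + 1) / Nc ^ D / (S / Nc ^ 2) := by rw [hSS, hEp, hE]
    _ = Nc ^ 3 * (ph * P * (Lc * Ep * E / (2 * S ^ 2))) := by rw [hN]; field_simp; ring

/-! ## §5 The source-side sums ARE alias-box sums of the label models -/

section Sums

variable {N M Lc : ℕ} [NeZero N] [NeZero M] [NeZero Lc]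

omit [NeZero M] [NeZero Lc] in
/-- [folklore] The force source pairs with any block vector through its `l`-entry: `u · f̂(m) = u_l · srcW(m, l, y′)`. -/
theorem dot_fhatF (p : Fin D → ℂ) (l : Fin D) (y' : Fin D → ℤ) (m : TorusSite D N) (u : Fin D → ℂ) :
    dot u (fhatF N M p l y' m) = u l * srcW N M p m l y' := by
  unfold FibreBlockSolve.dot fhatF
  simp [mul_ite]

/-- [folklore] RE-INDEXING (any additive target): a sum over the integer alias box is the sum over `(ℤ/N)^D`
(`CapacitanceScalarRateTerm.sum_boxZ` is the `ℝ`-valued case). -/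
theorem sum_boxZ' {E : Type*} [AddCommMonoid E] (p : Fin D → ℝ) (F : (Fin D → ℤ) → E) :
    ∑ z ∈ boxZ N p, F z = ∑ m : Fin D → ZMod N, F (zvec N p m) := by
  unfold boxZ
  rw [Finset.sum_image fun m _ m' _ h => zvec_injective p h]

/-- [folklore] `symN ≠ 0` at every zone label of a nonzero Brillouin momentum (`momSq_qv_pos` + `symN_inv_bounds`' Jordan bound). -/
theorem symN_label_ne_zero {q : Fin D → ℝ} (hq : ∀ i, |q i| ≤ π) (hq0 : q ≠ 0) (m : Fin D → ZMod N) :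
    ((symN N (qv q (zvec N q m)) : ℝ) : ℂ) ≠ 0 := by
  have hN : 0 < N := Nat.pos_of_ne_zero (NeZero.ne N)
  have hz : zvec N q m ∈ boxZ N q := Finset.mem_image_of_mem _ (Finset.mem_univ m)
  have hQ : ∀ i, |qv q (zvec N q m) i| ≤ π * N := abs_qv_le_of_mem_boxZ hq hz
  have hpos := momSq_qv_pos hq hq0 (zvec N q m)
  have h2 := SymbolTaylor.two_sided_sq_mul_lapSym (show (0 : ℝ) < N by exact_mod_cast hN) hQ
  have hlow : 4 / π ^ 2 * momSq (qv q (zvec N q m)) ≤ symN N (qv q (zvec N q m)) := h2.1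
  have : 0 < symN N (qv q (zvec N q m)) := lt_of_lt_of_le (by positivity) hlow
  exact_mod_cast this.ne'

/-- [folklore] **THE `S_c` SUMMAND AT THE LABEL**: at `p = ofRealVec q`, with `Q = q + 2π·zvec N q m`,
`S(m)·(∂♭_{m,l}·srcW(m,l,y′))/L_m² = N³ · (Lc · srcPh · Π_i pairP N M Q_i · eM Lc Q_l / symN N Q ²)`. -/
theorem srcC_summand_eq (hNM : N = M * Lc) {q : Fin D → ℝ} (hq : ∀ i, |q i| ≤ π) (hq0 : q ≠ 0) (l : Fin D) (y' : Fin D → ℤ)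
    (m : TorusSite D N) :
    SAl N (ofRealVec q) m * (dbAl N (ofRealVec q) m l * srcW N M (ofRealVec q) m l y') / LAl N (ofRealVec q) m ^ 2
      = (N : ℂ) ^ 3 * ((Lc : ℂ) * srcPh Lc y' (qv q (zvec N q m)) * (∏ i, pairP N M (qv q (zvec N q m) i)) *
          eM Lc (qv q (zvec N q m) l) / ((symN N (qv q (zvec N q m)) : ℝ) : ℂ) ^ 2) := by
  have hN : 0 < N := Nat.pos_of_ne_zero (NeZero.ne N)
  have hM : 0 < M := Nat.pos_of_ne_zero (NeZero.ne M)
  have hLc : 0 < Lc := Nat.pos_of_ne_zero (NeZero.ne Lc)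
  obtain ⟨n, hk⟩ := kAl_eq_label q m
  set Q := qv q (zvec N q m) with hQ
  rw [SAl_of_decomp hk, dbAl_of_decomp hk, srcW_of_decomp hk, LAl_of_decomp hk, lapSym_label hN Q, srcPhase_label hM hNM Q y']
  refine core_C D (by exact_mod_cast hM.ne') (by exact_mod_cast hLc.ne') (symN_label_ne_zero hq hq0 m) (by exact_mod_cast hNM)
    (prod_gs_mul_prod_gs hN hM Q) (gs_neg_mul_dflat hM hNM Q l)

/-- [folklore] **`S_c` IS AN ALIAS-BOX SUM** (unit `N³`): for `q ∈ [−π,π]^D ∖ {0}`, `N = M·Lc`,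
`srcC N (ofRealVec q) (fhatF N M (ofRealVec q) l y′) = N³ · Σ_{z ∈ boxZ N q} termC N M Lc l y′ (q + 2πz)`. -/
theorem srcC_fhatF_eq (hNM : N = M * Lc) {q : Fin D → ℝ} (hq : ∀ i, |q i| ≤ π) (hq0 : q ≠ 0) (l : Fin D) (y' : Fin D → ℤ) :
    srcC N (ofRealVec q) (fhatF N M (ofRealVec q) l y')
      = (N : ℂ) ^ 3 * ∑ z ∈ boxZ N q, termC N M Lc l y' (qv q z) := by
  have hN1 : 1 ≤ N := Nat.one_le_iff_ne_zero.2 (NeZero.ne N)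
  have hreg := reg_eq_univ N (ofRealVec q) (CapacitanceScalarDictionary.LAl_ofRealVec_ne_zero hN1 hq hq0)
  rw [srcC, hreg, sum_boxZ', Finset.mul_sum, ← Finset.sum_neg_distrib]
  refine Finset.sum_congr rfl fun m _ => ?_
  rw [dot_fhatF, srcC_summand_eq hNM hq hq0 l y' m, termC, mul_neg]

/-- [folklore] **THE `S_φ` SUMMAND AT THE LABEL**: at `p = ofRealVec q`, `Q = q + 2π·zvec N q m`,
`(S(m)/(2L_m))·s_{l′}(m)·(Π⊥_m f̂(m))_{l′} = −N³ · termPhi N M Lc q l′ l y′ Q`. -/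
theorem srcPhi_summand_eq (hNM : N = M * Lc) {q : Fin D → ℝ} (hq : ∀ i, |q i| ≤ π) (hq0 : q ≠ 0) (l' l : Fin D)
    (y' : Fin D → ℤ) (m : TorusSite D N) :
    SAl N (ofRealVec q) m / (2 * LAl N (ofRealVec q) m) * sAl N (ofRealVec q) m l' *
        piPerp (dAl N (ofRealVec q) m) (dbAl N (ofRealVec q) m) (LAl N (ofRealVec q) m) (fhatF N M (ofRealVec q) l y' m) l'
      = -((N : ℂ) ^ 3 * termPhi N M Lc q l' l y' (qv q (zvec N q m))) := by
  have hN : 0 < N := Nat.pos_of_ne_zero (NeZero.ne N)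
  have hM : 0 < M := Nat.pos_of_ne_zero (NeZero.ne M)
  have hLc : 0 < Lc := Nat.pos_of_ne_zero (NeZero.ne Lc)
  have hMc : (M : ℂ) ≠ 0 := by exact_mod_cast hM.ne'
  have hNc : (N : ℂ) ≠ 0 := by exact_mod_cast hN.ne'
  have hLcc : (Lc : ℂ) ≠ 0 := by exact_mod_cast hLc.ne'
  have hNMc : (N : ℂ) = M * Lc := by exact_mod_cast hNM
  obtain ⟨n, hk⟩ := kAl_eq_label q m
  set Q := qv q (zvec N q m) with hQ
  have hS := symN_label_ne_zero (N := N) hq hq0 m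
  have hSS := prod_gs_mul_prod_gs hN hM Q
  have hE := gs_neg_mul_dflat hM hNM Q l
  -- the transverse projection of the force source, entry `l′`
  have hpi : piPerp (dAl N (ofRealVec q) m) (dbAl N (ofRealVec q) m) (LAl N (ofRealVec q) m) (fhatF N M (ofRealVec q) l y' m) l'
      = (if l' = l then srcW N M (ofRealVec q) m l y' else 0)
        - dAl N (ofRealVec q) m l' * (dbAl N (ofRealVec q) m l * srcW N M (ofRealVec q) m l y') / LAl N (ofRealVec q) m := by
    unfold piPerp
    rw [dot_fhatF]
    rfl
  rw [hpi, mul_sub, termPhi, mul_neg, neg_neg, mul_sub, mul_sub]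
  congr 1
  · -- the `δ`-part
    split_ifs with hll
    · subst hll
      rw [SAl_of_decomp hk, sAl_of_decomp hk, srcW_of_decomp hk, LAl_of_decomp hk, lapSym_label hN Q, srcPhase_label hM hNM Q y']
      have hsl : gs ((Q l' / N : ℝ) : ℂ) N * gs (-((Q l' / N : ℝ) : ℂ)) M = ((N : ℂ) * M) * pairP N M (Q l') :=
        gs_mul_gs_eq_pairP hN hM (Q l')
      rw [core_Phi_delta D hMc hNc hS hSS hsl]
    · simp
  · -- the projector part
    rw [SAl_of_decomp hk, sAl_of_decomp hk, dAl_of_decomp hk, dbAl_of_decomp hk, srcW_of_decomp hk, LAl_of_decomp hk,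
      lapSym_label hN Q, srcPhase_label hM hNM Q y']
    rw [core_Phi_proj D hMc hLcc hS hNMc hSS (gs_mul_dhat q (zvec N q m) l') hE]

/-- [folklore] **`S_φ` IS AN ALIAS-BOX SUM** (unit `N³`): for `q ∈ [−π,π]^D ∖ {0}`, `N = M·Lc`,
`srcPhi N (ofRealVec q) (fhatF N M (ofRealVec q) l y′) 0 l′ = N³ · Σ_{z ∈ boxZ N q} termPhi N M Lc q l′ l y′ (q + 2πz)`. -/
theorem srcPhi_fhatF_eq (hNM : N = M * Lc) {q : Fin D → ℝ} (hq : ∀ i, |q i| ≤ π) (hq0 : q ≠ 0) (l' l : Fin D) (y' : Fin D → ℤ) :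
    srcPhi N (ofRealVec q) (fhatF N M (ofRealVec q) l y') 0 l'
      = (N : ℂ) ^ 3 * ∑ z ∈ boxZ N q, termPhi N M Lc q l' l y' (qv q z) := by
  have hN1 : 1 ≤ N := Nat.one_le_iff_ne_zero.2 (NeZero.ne N)
  have hreg := reg_eq_univ N (ofRealVec q) (CapacitanceScalarDictionary.LAl_ofRealVec_ne_zero hN1 hq hq0)
  rw [srcPhi, hreg, sum_boxZ', Finset.mul_sum, Pi.zero_apply, zero_sub, ← Finset.sum_neg_distrib]
  refine Finset.sum_congr rfl fun m _ => ?_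
  rw [srcPhi_summand_eq hNM hq hq0 l' l y' m, neg_neg]

end Sums

end Summit.QuantumFields.BalabanUV.Beta.GAN24.SourceSideDict

end
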